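import Literature.NumberTheory.Automorphic.AutomorphicSpectrum
import HarnessLib

/-!
# Strong continuity of the regular representation on `L²` of the automorphic quotient (proof)

Trunk `AutomorphicAxiomatic` (G19), topic `NumberTheory/Automorphic`; sibling proof file of
`AutomorphicSpectrum`, discharging its named fact
`Literature.NumberTheory.Automorphic.AdelicGroupData.isStronglyContinuous_rightRegular`:

*for an adelic group datum `𝒢` over a number field `K` and an automorphic measure `μ` on
`G(𝔸_K) ⧸ (A_G · G(K))`, every orbit map `g ↦ R(g) f` of the regular representation
`R = 𝒢.rightRegular μ` on `L²(G(𝔸_K) ⧸ A_G G(K), μ)` is continuous*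
(`isStronglyContinuous_rightRegular_holds`; Borel–Jacquet, Corvallis (1979), §4.6; Folland,
*A course in abstract harmonic analysis* (1995), §3.1, continuity of translation in `Lᵖ`).

`AutomorphicSpectrum` records why this was left as a named fact: Mathlib's
`MeasureTheory.Lp.instContinuousSMulDomMulAct` (joint continuity of the domain action of
`Mᵈᵐᵃ` on `Lp E p μ` for a locally finite, inner regular, `M`-invariant measure on an `R₁`
space `X` with continuous action) needs `[R1Space X]`, and the automorphic quotient
`G(𝔸_K) ⧸ (A_G · G(K))` is the quotient of a topological group by a subgroup which is neither
normal nor (in the tree, provably) closed, so that neither Mathlib's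
`QuotientGroup.instT3Space` (normal closed subgroups) nor `T2Space` is available. The missing
input is the classical point-set fact that **the quotient `G ⧸ H` of a topological group by an
arbitrary subgroup is a regular space** (closed neighbourhoods form a basis: if `V` is a
neighbourhood of `1` with `V⁻¹ V g ⊆ U`, then the closure of `π(V g)` in `G ⧸ H` lies in
`π(U)`, because `π(V h)` is a neighbourhood of `π(h)`, `π` being open), proved here as
`QuotientGroup.regularSpace_quotient` (a theorem, plus the instance
`AdelicGroupData.instRegularSpaceAutomorphicQuotient` on the tree's own type); regular spaces
are `R₁` (Mathlib), and the remaining hypotheses of the Mathlib instance are exactly the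
fields of `AdelicGroupData.IsAutomorphicMeasure` (finite, hence locally finite; inner regular
on finite-measure sets; invariant) together with the continuous action of `G(𝔸_K)` on the
quotient (`AdelicGroupData.instContinuousSMulAutomorphicQuotient`). Strong continuity of
`R(g) f = (DomMulAct.mk g⁻¹) • f` then follows from continuity of inversion and of
`DomMulAct.mk`.

## Design notes

* `Lp.instContinuousSMulDomMulAct` also asks for a measurable structure on the acting monoid
  with `OpensMeasurableSpace`; the abstract datum `𝒢.Adelic` carries none, so the proof equips
  it *locally* with its Borel σ-algebra (`borel`, `BorelSpace`), which does not appear in the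
  statement (the `SMul` of `G(𝔸_K)ᵈᵐᵃ` on `Lp` only depends on `Prop`-valued instances).
  Likewise `Fact ((2 : ℝ≥0∞) ≠ ∞)` is supplied locally.
* The regularity theorem is stated for every topological group and every subgroup (Mathlib
  generality, no separation hypothesis; the quotient need not be `T₀`). It lives in
  `namespace Literature.Automorphic` under the name `QuotientGroup.regularSpace_quotient` (no
  declaration is added to Mathlib's `QuotientGroup` namespace). The only new instance is on
  `AdelicGroupData.automorphicQuotient`, a type of this library, and duplicates no Mathlib
  instance.
* Nothing in `AutomorphicSpectrum` is restated or modified; consumers holding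
  `(h : 𝒢.isStronglyContinuous_rightRegular μ)` are fed
  `isStronglyContinuous_rightRegular_holds 𝒢 μ`, e.g. the bridge to G07 becomes
  `𝒢.rightRegularUnitaryRep μ (𝒢.isStronglyContinuous_rightRegular_holds μ)`.

## References

* A. Borel, H. Jacquet, *Automorphic forms and automorphic representations*, Proc. Sympos.
  Pure Math. 33 (Corvallis 1979), Part 1, §4.6 [BorelJacquetCorvallis1979].
* G. B. Folland, *A course in abstract harmonic analysis* (1995), §2.6 (homogeneous spaces
  `G/H`), §3.1 [Folland1995].
* E. Hewitt, K. A. Ross, *Abstract harmonic analysis I* (1963), §5 (quotient spaces `G/H` are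
  regular; `T₀` iff `H` is closed).
-/

noncomputable section

open MeasureTheory Topology Filter Set
open scoped ENNReal Pointwise

namespace Literature.NumberTheory.Automorphic

/-! ### Quotients of topological groups by arbitrary subgroups are regular -/

section Quotient

variable {G : Type*} [Group G] [TopologicalSpace G] [IsTopologicalGroup G]

/-- **The left-coset space `G ⧸ H` of a topological group by any subgroup is a regular space**
(no normality, no closedness; it is moreover `T₀`, hence `T₃`, iff `H` is closed). Proof: for
`π(g) ∈ π(U)` with `U` a neighbourhood of `g`, pick a neighbourhood `V` of `1` with
`a⁻¹ b g ∈ U` for `a, b ∈ V`; then the closure of the neighbourhood `π(V g)` of `π(g)` is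
contained in `π(U)`: if `π(h)` is adherent to `π(V g)`, the neighbourhood `π(V h)` of `π(h)`
(`π` is open, Mathlib `QuotientGroup.isOpenMap_coe`) meets `π(V g)`, i.e. `a h k = b g` with
`a, b ∈ V`, `k ∈ H`, whence `π(h) = π(a⁻¹ b g) ∈ π(U)`. Mathlib has the group case
(`IsTopologicalGroup.regularSpace`) and the normal closed case (`QuotientGroup.instT3Space`)
only (Hewitt–Ross, *Abstract harmonic analysis I*, §5; Folland (1995), §2.6). [folklore] -/
theorem QuotientGroup.regularSpace_quotient (H : Subgroup G) : RegularSpace (G ⧸ H) := by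
  refine .of_exists_mem_nhds_isClosed_subset fun x s hs => ?_
  obtain ⟨g, rfl⟩ := QuotientGroup.mk_surjective x
  rw [QuotientGroup.nhds_eq, Filter.mem_map] at hs
  have hf : Tendsto (fun p : G × G => p.1⁻¹ * p.2 * g) (𝓝 1 ×ˢ 𝓝 1) (𝓝 g) := by
    have hc : Continuous (fun p : G × G => p.1⁻¹ * p.2 * g) := by fun_prop
    simpa [nhds_prod_eq] using hc.tendsto (1, 1)
  obtain ⟨V₁, hV₁, V₂, hV₂, hV⟩ := Filter.mem_prod_iff.mp (hf hs)
  have hW : ∀ k : G, (fun x => x * k⁻¹) ⁻¹' (V₁ ∩ V₂) ∈ 𝓝 k := fun k => by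
    have hc : Continuous (fun x : G => x * k⁻¹) := by fun_prop
    refine hc.continuousAt.preimage_mem_nhds ?_
    simpa using inter_mem hV₁ hV₂
  refine ⟨closure (QuotientGroup.mk '' ((fun x => x * g⁻¹) ⁻¹' (V₁ ∩ V₂))), ?_, isClosed_closure,
    ?_⟩
  · exact mem_of_superset (QuotientGroup.isOpenMap_coe.image_mem_nhds (hW g)) subset_closure
  · intro y hy
    obtain ⟨h, rfl⟩ := QuotientGroup.mk_surjective y
    rw [mem_closure_iff_nhds] at hy
    obtain ⟨z, ⟨a', ha', rfl⟩, ⟨b', hb', hab⟩⟩ :=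
      hy _ (QuotientGroup.isOpenMap_coe.image_mem_nhds (hW h))
    have key : (a' * h⁻¹)⁻¹ * (b' * g⁻¹) * g ∈ QuotientGroup.mk ⁻¹' s :=
      hV (Set.mk_mem_prod ha'.1 hb'.2)
    have e : (QuotientGroup.mk h : G ⧸ H) = QuotientGroup.mk ((a' * h⁻¹)⁻¹ * (b' * g⁻¹) * g) := by
      rw [QuotientGroup.eq]
      have h1 : a'⁻¹ * b' ∈ H := QuotientGroup.eq.mp hab.symm
      have h2 : h⁻¹ * ((a' * h⁻¹)⁻¹ * (b' * g⁻¹) * g) = a'⁻¹ * b' := by group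
      rwa [h2]
    rw [e]
    exact key

end Quotient

/-! ### The automorphic quotient is regular; the regular representation is strongly continuous -/

namespace AdelicGroupData

universe u

variable {K : Type} [Field K] [NumberField K] (𝒢 : AdelicGroupData.{u} K)

/-- The automorphic quotient `G(𝔸_K) ⧸ (A_G · G(K))` is a regular topological space (quotient of
the topological group `G(𝔸_K)` by a subgroup, `QuotientGroup.regularSpace_quotient`); in
particular it is an `R₁` space, which is what Mathlib's continuity of the domain action on `Lᵖ`
consumes. (Hausdorffness is the separate named fact `t2Space_automorphicQuotient_gl` for
`GL_n`.) Instance on a type of this library (Hewitt–Ross I, §5; Borel–Jacquet (1979), §4.6).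
[folklore] -/
instance instRegularSpaceAutomorphicQuotient : RegularSpace 𝒢.automorphicQuotient :=
  QuotientGroup.regularSpace_quotient _

variable (μ : Measure 𝒢.automorphicQuotient) [𝒢.IsAutomorphicMeasure μ]

/-- **The regular representation of `G(𝔸_K)` on `L²(G(𝔸_K) ⧸ A_G G(K), μ)` is strongly
continuous** for every automorphic measure `μ`: the named fact
`isStronglyContinuous_rightRegular` of `AutomorphicSpectrum`, now proved. With the quotient
regular (`instRegularSpaceAutomorphicQuotient`), `μ` finite (hence locally finite), inner
regular on sets of finite measure and `G(𝔸_K)`-invariant (`IsAutomorphicMeasure`), and the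
action of `G(𝔸_K)` on the quotient continuous, Mathlib's
`MeasureTheory.Lp.instContinuousSMulDomMulAct` gives joint continuity of
`(c, f) ↦ c • f` on `G(𝔸_K)ᵈᵐᵃ × L²`; and `R(g) f = DomMulAct.mk g⁻¹ • f`
(`rightRegular_apply`) with `g ↦ DomMulAct.mk g⁻¹` continuous (Borel–Jacquet (1979), §4.6;
Folland (1995), Prop. 2.41 and §3.1). [cite: BorelJacquetCorvallis1979, §4.6] -/
theorem isStronglyContinuous_rightRegular_holds : 𝒢.isStronglyContinuous_rightRegular μ := by
  intro f
  letI : MeasurableSpace 𝒢.Adelic := borel _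
  haveI : BorelSpace 𝒢.Adelic := ⟨rfl⟩
  haveI : Fact ((2 : ℝ≥0∞) ≠ ∞) := ⟨ENNReal.ofNat_ne_top⟩
  simp only [rightRegular_apply]
  exact (DomMulAct.continuous_mk.comp continuous_inv).smul continuous_const

end AdelicGroupData

end Literature.NumberTheory.Automorphic
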